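import Mathlib
import Literature.NumberTheory.Sieve.VinogradovExpSumTools
import Literature.NumberTheory.Sieve.RamanujanSum
import HarnessLib

/-!
# Counting points modulo one in an interval: a Fejér-kernel form of the Erdős–Turán inequality — PROVED

Topic `NumberTheory/Sieve` (exponential sums; companion of `VinogradovExpSumTools.lean`, whose
distance-to-the-nearest-integer `Vinogradov.distInt` and geometric-sum bound
`Vinogradov.norm_sum_Ioc_fourierChar_mul_distInt_le` are used).  For finitely many real numbers
`x_i` and an interval `[α, β)` of length `β − α ≤ 1`, the number of `i` with `x_i ∈ [α, β) (mod 1)`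
is `(β − α) N` up to an error controlled by the exponential sums `S(h) = ∑_i e(h x_i)`,
`0 < |h| ≤ H`.  We PROVE the elementary two-sided version obtained by smoothing the indicator of a
`δ`-widened / `δ`-shrunk interval with the FEJÉR KERNEL
`K_H(t) = |∑_{n=1}^{H+1} e(nt)|² / (H + 1) ≥ 0` (a trigonometric polynomial of degree `H` with
`∫_0^1 K_H = 1` and `∫_{δ ≤ |t| ≤ 1/2} K_H ≤ 1/(2(H+1)δ)`):

* `card_filter_fract_lt_le` — for `0 < δ ≤ 1/4`, `(H + 1)δ ≥ 1`, `α ≤ β ≤ α + 1`,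
  `#{i : {x_i − α} < β − α} ≤ (β − α)N + 2δN + 2N/((H+1)δ) + ∑_{0<|h|≤H} |S(h)|/|h|`;
* `le_card_filter_fract_lt` — the matching lower bound
  `#{i : {x_i − α} < β − α} ≥ (β − α)N − 2δN − N/((H+1)δ) − ∑_{0<|h|≤H} |S(h)|/|h|`.

This is weaker than the Erdős–Turán inequality proper (error `N/(H+1)` there, `N/√H` here after
optimising `δ`), but it is elementary, explicit and finite (no Fourier series, no Beurling–Selberg
functions), which is all that discrepancy estimates with a power saving need (e.g. Iwaniec, Invent.
Math. 47 (1978), Lemma 4, where it can replace his Lemma 7).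

## References

* P. Erdős, P. Turán, *On a problem in the theory of uniform distribution I, II*, Indag. Math. 10
  (1948) 370–378, 406–413.
* H. L. Montgomery, *Ten lectures on the interface between analytic number theory and harmonic
  analysis*, CBMS 84 (1994), Ch. 1.
* I. M. Vinogradov, *The method of trigonometrical sums in the theory of numbers*, Ch. I, Lemma 12.
-/

noncomputable section

open Finset Real MeasureTheory intervalIntegral
open scoped FourierTransform

namespace Literature.NumberTheory.Sieve.FejerCounting

open Literature.NumberTheory.Sieve.Vinogradov (distInt distInt_nonneg distInt_le_half
  norm_sum_Ioc_fourierChar_mul_distInt_le norm_fourierChar)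
open Literature.NumberTheory.Sieve.RamanujanSum (fourierChar_intCast)

/-! ### The character `e(x)`: periodicity, conjugation, continuity, integrals -/

/-- `e(x + k) = e(x)` for an integer `k`. [folklore] -/
theorem fourierChar_add_intCast (x : ℝ) (k : ℤ) : (𝐞 (x + k) : ℂ) = 𝐞 x := by
  rw [AddChar.map_add_eq_mul, Circle.coe_mul, fourierChar_intCast, mul_one]

/-- `conj e(x) = e(−x)`. [folklore] -/
theorem conj_fourierChar (x : ℝ) : starRingEnd ℂ (𝐞 x : ℂ) = 𝐞 (-x) := by
  rw [AddChar.map_neg_eq_inv, Circle.coe_inv_eq_conj]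

/-- `e(x) e(−y) = e(x − y)`. [folklore] -/
theorem fourierChar_mul_fourierChar_neg (x y : ℝ) : (𝐞 x : ℂ) * 𝐞 (-y) = 𝐞 (x - y) := by
  rw [← Circle.coe_mul, ← AddChar.map_add_eq_mul, sub_eq_add_neg]

/-- `t ↦ e(ct)` is continuous. [folklore] -/
theorem continuous_fourierChar_mul (c : ℝ) : Continuous fun t : ℝ => (𝐞 (c * t) : ℂ) :=
  continuous_subtype_val.comp (Real.continuous_fourierChar.comp (continuous_const.mul continuous_id))

/-- `e(ct) = exp((2πic) t)`. [folklore] -/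
theorem fourierChar_mul_eq_exp (c t : ℝ) :
    (𝐞 (c * t) : ℂ) = Complex.exp ((2 * Real.pi * c * Complex.I : ℂ) * t) := by
  rw [Real.fourierChar_apply]
  congr 1
  push_cast
  ring

/-- `∫_a^b e(ct) dt = (e(cb) − e(ca))/(2πic)` for `c ≠ 0`. [folklore] -/
theorem integral_fourierChar_mul {c : ℝ} (hc : c ≠ 0) (a b : ℝ) :
    ∫ t in a..b, (𝐞 (c * t) : ℂ) = ((𝐞 (c * b) : ℂ) - 𝐞 (c * a)) / (2 * Real.pi * c * Complex.I) := by
  simp_rw [fourierChar_mul_eq_exp]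
  have hc' : (2 * Real.pi * c * Complex.I : ℂ) ≠ 0 := by
    have hπ : (Real.pi : ℂ) ≠ 0 := Complex.ofReal_ne_zero.mpr Real.pi_pos.ne'
    have hcc : (c : ℂ) ≠ 0 := Complex.ofReal_ne_zero.mpr hc
    simp [hπ, hcc, Complex.I_ne_zero]
  exact integral_exp_mul_complex hc'

/-- `|∫_a^b e(ct) dt| ≤ 1/(π|c|)` for `c ≠ 0`. [folklore] -/
theorem norm_integral_fourierChar_mul_le {c : ℝ} (hc : c ≠ 0) (a b : ℝ) :
    ‖∫ t in a..b, (𝐞 (c * t) : ℂ)‖ ≤ 1 / (Real.pi * |c|) := by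
  rw [integral_fourierChar_mul hc, norm_div]
  have hden : ‖(2 * Real.pi * c * Complex.I : ℂ)‖ = 2 * Real.pi * |c| := by
    simp [abs_of_pos Real.pi_pos]
  rw [hden]
  have hnum : ‖(𝐞 (c * b) : ℂ) - 𝐞 (c * a)‖ ≤ 2 := by
    calc ‖(𝐞 (c * b) : ℂ) - 𝐞 (c * a)‖ ≤ ‖(𝐞 (c * b) : ℂ)‖ + ‖(𝐞 (c * a) : ℂ)‖ := norm_sub_le _ _
      _ = 2 := by rw [norm_fourierChar, norm_fourierChar]; norm_num
  have hpos : 0 < Real.pi * |c| := mul_pos Real.pi_pos (abs_pos.mpr hc)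
  rw [div_le_div_iff₀ (by positivity) hpos]
  nlinarith

/-- `∫_a^{a+1} e(kt) dt = 0` for a nonzero integer `k`. [folklore] -/
theorem integral_fourierChar_intCast_mul {k : ℤ} (hk : k ≠ 0) (a : ℝ) :
    ∫ t in a..a + 1, (𝐞 ((k : ℝ) * t) : ℂ) = 0 := by
  rw [integral_fourierChar_mul (by exact_mod_cast hk), mul_add, mul_one,
    show (k : ℝ) * a + k = (k : ℝ) * a + ((k : ℤ) : ℝ) by rfl, fourierChar_add_intCast, sub_self,
    zero_div]

/-! ### The Dirichlet sum and the Fejér kernel -/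

/-- `D_H(t) = ∑_{n=1}^{H+1} e(nt)`. [folklore] -/
def dirichletSum (H : ℕ) (t : ℝ) : ℂ := ∑ n ∈ Ioc 0 (H + 1), (𝐞 ((n : ℝ) * t) : ℂ)

/-- The Fejér kernel `K_H(t) = |D_H(t)|² / (H + 1)` (a nonnegative trigonometric polynomial of
degree `H` with mean `1`). [folklore] -/
def fejerKernel (H : ℕ) (t : ℝ) : ℝ := ‖dirichletSum H t‖ ^ 2 / (H + 1)

variable (H : ℕ)

/-- `K_H ≥ 0`. [folklore] -/
theorem fejerKernel_nonneg (t : ℝ) : 0 ≤ fejerKernel H t := by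
  unfold fejerKernel; positivity

/-- `D_H` is continuous. [folklore] -/
theorem continuous_dirichletSum : Continuous (dirichletSum H) := by
  unfold dirichletSum
  exact continuous_finsetSum _ fun n _ => continuous_fourierChar_mul (n : ℝ)

/-- `K_H` is continuous. [folklore] -/
theorem continuous_fejerKernel : Continuous (fejerKernel H) := by
  unfold fejerKernel
  exact ((continuous_dirichletSum H).norm.pow 2).div_const _

/-- `K_H` is interval integrable on every interval. [folklore] -/
theorem intervalIntegrable_fejerKernel (a b : ℝ) :
    IntervalIntegrable (fejerKernel H) volume a b :=
  (continuous_fejerKernel H).intervalIntegrable a b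

/-- `D_H(t + k) = D_H(t)` for an integer `k`. [folklore] -/
theorem dirichletSum_add_intCast (t : ℝ) (k : ℤ) : dirichletSum H (t + k) = dirichletSum H t := by
  unfold dirichletSum
  refine Finset.sum_congr rfl fun n _ => ?_
  rw [mul_add, show (n : ℝ) * (k : ℝ) = (((n : ℤ) * k : ℤ) : ℝ) by push_cast; ring,
    fourierChar_add_intCast]

/-- `K_H` is `1`-periodic. [folklore] -/
theorem fejerKernel_periodic : Function.Periodic (fejerKernel H) 1 := by
  intro t
  unfold fejerKernel
  rw [show t + 1 = t + ((1 : ℤ) : ℝ) by push_cast; ring, dirichletSum_add_intCast]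

/-- `K_H(t + k) = K_H(t)` for an integer `k`. [folklore] -/
theorem fejerKernel_add_intCast (t : ℝ) (k : ℤ) : fejerKernel H (t + k) = fejerKernel H t := by
  unfold fejerKernel
  rw [dirichletSum_add_intCast]

/-- `D_H(−t) = conj D_H(t)`. [folklore] -/
theorem dirichletSum_neg (t : ℝ) : dirichletSum H (-t) = starRingEnd ℂ (dirichletSum H t) := by
  unfold dirichletSum
  rw [map_sum]
  refine Finset.sum_congr rfl fun n _ => ?_
  rw [conj_fourierChar, mul_neg]

/-- `K_H` is even. [folklore] -/
theorem fejerKernel_neg (t : ℝ) : fejerKernel H (-t) = fejerKernel H t := by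
  unfold fejerKernel
  rw [dirichletSum_neg, Complex.norm_conj]

/-- **The Fejér kernel as a trigonometric polynomial**:
`K_H(t) = (H+1)⁻¹ ∑_{n,n'=1}^{H+1} e((n − n')t)`. [folklore] -/
theorem fejerKernel_eq_sum (t : ℝ) :
    (fejerKernel H t : ℂ) = ((H : ℂ) + 1)⁻¹ *
      ∑ n ∈ Ioc 0 (H + 1), ∑ n' ∈ Ioc 0 (H + 1), (𝐞 (((n : ℝ) - n') * t) : ℂ) := by
  unfold fejerKernel
  have hsq : ((‖dirichletSum H t‖ ^ 2 : ℝ) : ℂ) = dirichletSum H t * starRingEnd ℂ (dirichletSum H t) := by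
    rw [Complex.mul_conj, Complex.normSq_eq_norm_sq]
  rw [Complex.ofReal_div, hsq, div_eq_inv_mul]
  push_cast
  congr 1
  unfold dirichletSum
  rw [map_sum, Finset.sum_mul_sum]
  refine Finset.sum_congr rfl fun n _ => Finset.sum_congr rfl fun n' _ => ?_
  rw [conj_fourierChar, fourierChar_mul_fourierChar_neg, sub_mul]

/-- **Pointwise bound**: `K_H(t) ≤ 1/(4(H+1)‖t‖²)` when `‖t‖ ≠ 0` (from the geometric-sum bound
`|D_H(t)| ≤ 1/(2‖t‖)`). [folklore] -/
theorem fejerKernel_le_inv_sq {t : ℝ} (ht : 0 < distInt t) :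
    fejerKernel H t ≤ 1 / (4 * (H + 1) * distInt t ^ 2) := by
  have hD : ‖dirichletSum H t‖ ≤ 1 / (2 * distInt t) := by
    rw [le_div_iff₀ (by positivity)]
    have h := norm_sum_Ioc_fourierChar_mul_distInt_le 0 (H + 1) t
    unfold dirichletSum
    linarith
  unfold fejerKernel
  have hH : (0 : ℝ) < H + 1 := by positivity
  rw [div_le_div_iff₀ hH (by positivity)]
  have h2 : ‖dirichletSum H t‖ ^ 2 ≤ (1 / (2 * distInt t)) ^ 2 :=
    pow_le_pow_left₀ (norm_nonneg _) hD 2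
  have h3 : (1 / (2 * distInt t)) ^ 2 * (4 * (H + 1) * distInt t ^ 2) = 1 * (H + 1) := by
    field_simp; ring
  calc ‖dirichletSum H t‖ ^ 2 * (4 * (H + 1) * distInt t ^ 2)
      ≤ (1 / (2 * distInt t)) ^ 2 * (4 * (H + 1) * distInt t ^ 2) :=
        mul_le_mul_of_nonneg_right h2 (by positivity)
    _ = 1 * (H + 1) := h3

/-! ### Integrals of the Fejér kernel -/

/-- **Mean one**: `∫_a^{a+1} K_H = 1`. [folklore] -/
theorem integral_fejerKernel (a : ℝ) : ∫ t in a..a + 1, fejerKernel H t = 1 := by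
  have hC : ∫ t in a..a + 1, (fejerKernel H t : ℂ) = 1 := by
    simp_rw [fejerKernel_eq_sum]
    rw [intervalIntegral.integral_const_mul, intervalIntegral.integral_finsetSum (fun n _ =>
      (continuous_finsetSum _ fun n' _ => continuous_fourierChar_mul _).intervalIntegrable _ _)]
    have hinner : ∀ n ∈ Ioc 0 (H + 1), ∫ t in a..a + 1, ∑ n' ∈ Ioc 0 (H + 1),
        (𝐞 (((n : ℝ) - n') * t) : ℂ) = 1 := by
      intro n hn
      rw [intervalIntegral.integral_finsetSum (fun n' _ => (continuous_fourierChar_mul _).intervalIntegrable _ _)]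
      have hterm : ∀ n' ∈ Ioc 0 (H + 1), ∫ t in a..a + 1, (𝐞 (((n : ℝ) - n') * t) : ℂ) =
          if n' = n then 1 else 0 := by
        intro n' _
        split_ifs with h
        · subst h
          have h1 : ∀ t : ℝ, (𝐞 (((n' : ℝ) - n') * t) : ℂ) = 1 := fun t => by simp
          simp_rw [h1]
          rw [intervalIntegral.integral_const]
          simp
        · have hk : ((n : ℤ) - n' : ℤ) ≠ 0 := by omega
          have := integral_fourierChar_intCast_mul hk a
          push_cast at this
          exact this
      rw [Finset.sum_congr rfl hterm, Finset.sum_ite_eq' (Ioc 0 (H + 1)) n (fun _ => (1 : ℂ)),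
        if_pos hn]
    rw [Finset.sum_congr rfl hinner, Finset.sum_const, Nat.card_Ioc, tsub_zero, nsmul_eq_mul,
      mul_one]
    push_cast
    exact inv_mul_cancel₀ (by exact_mod_cast Nat.succ_ne_zero H)
  rw [intervalIntegral.integral_ofReal] at hC
  exact_mod_cast hC

/-- For `0 ≤ t ≤ 1/2`, `‖t‖ = t`. [folklore] -/
theorem distInt_eq_self {t : ℝ} (h0 : 0 ≤ t) (h2 : t ≤ 1 / 2) : distInt t = t := by
  unfold distInt
  rcases h2.lt_or_eq with hlt | heq
  · have : round t = 0 := round_eq_zero_iff.mpr ⟨by linarith, hlt⟩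
    rw [this, Int.cast_zero, sub_zero, abs_of_nonneg h0]
  · rw [heq, round_eq, show (1 / 2 : ℝ) + 1 / 2 = 1 by norm_num, Int.floor_one]
    norm_num

/-- On `[δ, 1/2]` (`δ > 0`): `K_H(t) ≤ 1/(4(H+1)t²)`. [folklore] -/
theorem fejerKernel_le_of_mem_Icc {δ t : ℝ} (hδ : 0 < δ) (ht : t ∈ Set.Icc δ (1 / 2)) :
    fejerKernel H t ≤ 1 / (4 * (H + 1) * t ^ 2) := by
  have hd : distInt t = t := distInt_eq_self (hδ.le.trans ht.1) ht.2
  have h := fejerKernel_le_inv_sq H (t := t) (by rw [hd]; exact hδ.trans_le ht.1)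
  rwa [hd] at h

/-- `∫_δ^{1/2} dt/t² = 1/δ − 2`. [folklore] -/
theorem integral_inv_sq {δ : ℝ} (hδ : 0 < δ) (hδ2 : δ ≤ 1 / 2) :
    ∫ t in δ..(1 / 2), (t ^ 2)⁻¹ = 1 / δ - 2 := by
  have hderiv : ∀ x ∈ Set.uIcc δ (1 / 2), HasDerivAt (fun x : ℝ => -x⁻¹) ((x ^ 2)⁻¹) x := by
    intro x hx
    rw [Set.uIcc_of_le hδ2] at hx
    have hx0 : x ≠ 0 := (hδ.trans_le hx.1).ne'
    have h := (hasDerivAt_inv hx0).neg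
    simp only [neg_neg] at h
    exact h
  have hint : IntervalIntegrable (fun x : ℝ => (x ^ 2)⁻¹) volume δ (1 / 2) := by
    refine (continuousOn_of_forall_continuousAt fun x hx => ?_).intervalIntegrable
    rw [Set.uIcc_of_le hδ2] at hx
    have hx0 : x ≠ 0 := (hδ.trans_le hx.1).ne'
    exact (continuousAt_pow x 2).inv₀ (pow_ne_zero 2 hx0)
  rw [intervalIntegral.integral_eq_sub_of_hasDerivAt hderiv hint]
  norm_num
  ring

/-- `∫_δ^{1/2} K_H ≤ (1/δ − 2)/(4(H+1))`. [folklore] -/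
theorem integral_fejerKernel_half_le {δ : ℝ} (hδ : 0 < δ) (hδ2 : δ ≤ 1 / 2) :
    ∫ t in δ..(1 / 2), fejerKernel H t ≤ (1 / δ - 2) / (4 * (H + 1)) := by
  have hint : IntervalIntegrable (fun t : ℝ => 1 / (4 * (H + 1) * t ^ 2)) volume δ (1 / 2) := by
    refine (continuousOn_of_forall_continuousAt fun x hx => ?_).intervalIntegrable
    rw [Set.uIcc_of_le hδ2] at hx
    have hx0 : x ≠ 0 := (hδ.trans_le hx.1).ne'
    exact continuousAt_const.div ((continuousAt_const.mul (continuousAt_pow x 2)))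
      (mul_ne_zero (by positivity) (pow_ne_zero 2 hx0))
  calc ∫ t in δ..(1 / 2), fejerKernel H t ≤ ∫ t in δ..(1 / 2), 1 / (4 * (H + 1) * t ^ 2) :=
        intervalIntegral.integral_mono_on hδ2 (intervalIntegrable_fejerKernel H _ _) hint
          fun t ht => fejerKernel_le_of_mem_Icc H hδ ht
    _ = (4 * ((H : ℝ) + 1))⁻¹ * ∫ t in δ..(1 / 2), (t ^ 2)⁻¹ := by
        rw [← intervalIntegral.integral_const_mul]
        refine intervalIntegral.integral_congr fun t _ => ?_
        simp only [one_div, mul_inv]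
    _ = (1 / δ - 2) / (4 * (H + 1)) := by rw [integral_inv_sq hδ hδ2]; ring

/-- Symmetry of the tail: `∫_{1/2}^{1−δ} K_H = ∫_δ^{1/2} K_H`. [folklore] -/
theorem integral_fejerKernel_symm (δ : ℝ) :
    ∫ t in (1 / 2)..(1 - δ), fejerKernel H t = ∫ t in δ..(1 / 2), fejerKernel H t := by
  have h := intervalIntegral.integral_comp_sub_left (fun t => fejerKernel H t) (1 : ℝ)
    (a := δ) (b := 1 / 2)
  rw [show (1 : ℝ) - 1 / 2 = 1 / 2 by norm_num] at h
  rw [← h]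
  refine intervalIntegral.integral_congr fun t _ => ?_
  rw [sub_eq_neg_add, show (1 : ℝ) = ((1 : ℤ) : ℝ) by norm_num, fejerKernel_add_intCast,
    fejerKernel_neg]

/-- **Tail bound**: `∫_δ^{1−δ} K_H ≤ 1/(2(H+1)δ)` for `0 < δ ≤ 1/2`. [folklore] -/
theorem integral_fejerKernel_tail_le {δ : ℝ} (hδ : 0 < δ) (hδ2 : δ ≤ 1 / 2) :
    ∫ t in δ..(1 - δ), fejerKernel H t ≤ 1 / (2 * (H + 1) * δ) := by
  rw [← intervalIntegral.integral_add_adjacent_intervals (b := 1 / 2)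
    (intervalIntegrable_fejerKernel H _ _) (intervalIntegrable_fejerKernel H _ _),
    integral_fejerKernel_symm]
  have h := integral_fejerKernel_half_le H hδ hδ2
  have hH : (0 : ℝ) < H + 1 := by positivity
  have key : 2 * ((1 / δ - 2) / (4 * (H + 1))) ≤ 1 / (2 * (H + 1) * δ) := by
    rw [show 2 * ((1 / δ - 2) / (4 * (H + 1))) = 1 / (2 * (H + 1) * δ) - 1 / (H + 1) by
      field_simp; ring]
    have : 0 < 1 / ((H : ℝ) + 1) := by positivity
    linarith
  linarith

/-- **Mass near zero**: `∫_{−δ}^{δ} K_H ≥ 1 − 1/(2(H+1)δ)` for `0 < δ ≤ 1/2`. [folklore] -/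
theorem le_integral_fejerKernel_near_zero {δ : ℝ} (hδ : 0 < δ) (hδ2 : δ ≤ 1 / 2) :
    1 - 1 / (2 * (H + 1) * δ) ≤ ∫ t in (-δ)..δ, fejerKernel H t := by
  have hper : ∫ t in (-δ)..(-δ + 1), fejerKernel H t = 1 := by
    rw [(fejerKernel_periodic H).intervalIntegral_add_eq (-δ) 0, zero_add,
      show (0 : ℝ) = 0 + 1 - 1 by ring]
    simpa using integral_fejerKernel H 0
  have hsplit := intervalIntegral.integral_add_adjacent_intervals (a := -δ) (b := δ) (c := -δ + 1)
    (intervalIntegrable_fejerKernel H _ _) (intervalIntegrable_fejerKernel H _ _)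
  rw [hper, show -δ + 1 = 1 - δ by ring] at hsplit
  have htail := integral_fejerKernel_tail_le H hδ hδ2
  linarith

/-! ### Smoothed counting: the sums `∑_i ∫_a^b K_H(x_i − t) dt` -/

/-- **The smoothed sum as a double exponential sum**: for `y ∈ ℝ`,
`∫_a^b K_H(y − t) dt = (H+1)⁻¹ ∑_{n,n'} e((n − n')y) ∫_a^b e((n' − n)t) dt`. [folklore] -/
theorem integral_fejerKernel_sub_eq_sum (y a b : ℝ) :
    ((∫ t in a..b, fejerKernel H (y - t) : ℝ) : ℂ) = ((H : ℂ) + 1)⁻¹ *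
      ∑ n ∈ Ioc 0 (H + 1), ∑ n' ∈ Ioc 0 (H + 1),
        (𝐞 (((n : ℝ) - n') * y) : ℂ) * ∫ t in a..b, (𝐞 (((n' : ℝ) - n) * t) : ℂ) := by
  rw [← intervalIntegral.integral_ofReal]
  simp_rw [fejerKernel_eq_sum]
  have hcont : ∀ n n' : ℕ, Continuous fun t : ℝ => (𝐞 (((n : ℝ) - n') * (y - t)) : ℂ) :=
    fun n n' => (continuous_fourierChar_mul _).comp (continuous_const.sub continuous_id)
  rw [intervalIntegral.integral_const_mul, intervalIntegral.integral_finsetSum (fun n _ =>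
    (continuous_finsetSum _ fun n' _ => hcont n n').intervalIntegrable _ _)]
  congr 1
  refine Finset.sum_congr rfl fun n _ => ?_
  rw [intervalIntegral.integral_finsetSum (fun n' _ => (hcont n n').intervalIntegrable _ _)]
  refine Finset.sum_congr rfl fun n' _ => ?_
  rw [← intervalIntegral.integral_const_mul]
  refine intervalIntegral.integral_congr fun t _ => ?_
  rw [← Circle.coe_mul, ← AddChar.map_add_eq_mul]
  congr 2
  ring

/-- **Fibres of `(n, n') ↦ n − n'`**: for `F ≥ 0`,
`∑_{n ≠ n' ∈ (0, H+1]} F(n − n') ≤ (H + 1) ∑_{0 < |d| ≤ H} F(d)`. [folklore] -/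
theorem sum_sum_erase_le (F : ℤ → ℝ) (hF : ∀ d, 0 ≤ F d) :
    ∑ n ∈ Ioc 0 (H + 1), ∑ n' ∈ (Ioc 0 (H + 1)).erase n, F ((n : ℤ) - n') ≤
      (H + 1) * ∑ d ∈ (Icc (-(H : ℤ)) H).erase 0, F d := by
  classical
  set P := Ioc 0 (H + 1) with hP
  set D := (Icc (-(H : ℤ)) H).erase 0 with hD
  -- as a sum over the off-diagonal pairs
  have h1 : ∑ n ∈ P, ∑ n' ∈ P.erase n, F ((n : ℤ) - n') =
      ∑ q ∈ (P ×ˢ P).filter (fun q : ℕ × ℕ => q.1 ≠ q.2), F ((q.1 : ℤ) - q.2) := by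
    rw [Finset.sum_filter, Finset.sum_product]
    refine Finset.sum_congr rfl fun n _ => ?_
    rw [← Finset.sum_filter]
    congr 1
    ext n'
    simp [Finset.mem_erase, ne_comm, and_comm]
  rw [h1]
  have hmaps : ∀ q ∈ (P ×ˢ P).filter (fun q : ℕ × ℕ => q.1 ≠ q.2),
      ((q.1 : ℤ) - q.2) ∈ D := by
    intro q hq
    rw [Finset.mem_filter, Finset.mem_product, hP, Finset.mem_Ioc, Finset.mem_Ioc] at hq
    rw [hD, Finset.mem_erase, Finset.mem_Icc]
    refine ⟨?_, ?_, ?_⟩ <;> omega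
  rw [← Finset.sum_fiberwise_of_maps_to hmaps]
  rw [Finset.mul_sum]
  refine Finset.sum_le_sum fun d _ => ?_
  set fib := ((P ×ˢ P).filter (fun q : ℕ × ℕ => q.1 ≠ q.2)).filter
    (fun q : ℕ × ℕ => ((q.1 : ℤ) - q.2) = d) with hfib
  have hconst : ∑ q ∈ fib, F ((q.1 : ℤ) - q.2) = (fib.card : ℝ) * F d := by
    rw [Finset.sum_congr rfl (fun q hq => by rw [(Finset.mem_filter.mp hq).2]), Finset.sum_const,
      nsmul_eq_mul]
  rw [hconst]
  refine mul_le_mul_of_nonneg_right ?_ (hF d)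
  -- the fibre injects into `P` by the first coordinate
  have hinj : Set.InjOn (fun q : ℕ × ℕ => q.1) ↑fib := by
    intro q hq q' hq' h
    simp only [hfib, Finset.coe_filter, Set.mem_setOf_eq] at hq hq'
    have h2 : (q.2 : ℤ) = q'.2 := by
      have := hq.2; have := hq'.2; simp only at h; omega
    exact Prod.ext h (by exact_mod_cast h2)
  have hmaps' : ∀ q ∈ fib, (fun q : ℕ × ℕ => q.1) q ∈ P := fun q hq => by
    simp only [hfib, Finset.mem_filter, Finset.mem_product] at hq
    exact hq.1.1.1
  have hcard := Finset.card_le_card_of_injOn (fun q : ℕ × ℕ => q.1) hmaps' hinj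
  calc (fib.card : ℝ) ≤ (P.card : ℝ) := by exact_mod_cast hcard
    _ = H + 1 := by rw [hP, Nat.card_Ioc, tsub_zero]; push_cast; ring

/-- **The smoothed count is the main term up to the exponential sums**:
`|∑_i ∫_a^b K_H(x_i − t) dt − (b − a) N| ≤ ∑_{0<|d|≤H} |S(d)|/(π|d|)`. [folklore] -/
theorem abs_sum_integral_fejerKernel_sub_le {ι : Type*} (s : Finset ι) (x : ι → ℝ) (a b : ℝ) :
    |∑ i ∈ s, (∫ t in a..b, fejerKernel H (x i - t)) - (b - a) * s.card| ≤
      ∑ d ∈ (Icc (-(H : ℤ)) H).erase 0,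
        ‖∑ i ∈ s, (𝐞 ((d : ℝ) * x i) : ℂ)‖ / (Real.pi * |(d : ℝ)|) := by
  classical
  set P := Ioc 0 (H + 1) with hP
  set c : ℕ → ℕ → ℂ := fun n n' => ∫ t in a..b, (𝐞 (((n' : ℝ) - n) * t) : ℂ) with hc
  set S : ℕ → ℕ → ℂ := fun n n' => ∑ i ∈ s, (𝐞 (((n : ℝ) - n') * x i) : ℂ) with hS
  have hH : ((H : ℂ) + 1) ≠ 0 := by exact_mod_cast Nat.succ_ne_zero H
  -- the sum in complex form
  have hsum : ((∑ i ∈ s, ∫ t in a..b, fejerKernel H (x i - t) : ℝ) : ℂ) =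
      ((H : ℂ) + 1)⁻¹ * ∑ n ∈ P, ∑ n' ∈ P, c n n' * S n n' := by
    push_cast
    simp_rw [integral_fejerKernel_sub_eq_sum]
    rw [← Finset.mul_sum]
    congr 1
    rw [Finset.sum_comm]
    refine Finset.sum_congr rfl fun n _ => ?_
    rw [Finset.sum_comm]
    refine Finset.sum_congr rfl fun n' _ => ?_
    simp only [hc, hS]
    rw [Finset.mul_sum]
    refine Finset.sum_congr rfl fun i _ => ?_
    ring
  -- diagonal terms
  have hdiag : ∀ n ∈ P, c n n * S n n = ((b - a) * s.card : ℝ) := by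
    intro n _
    simp only [hc, hS, sub_self, zero_mul, AddChar.map_zero_eq_one, Circle.coe_one]
    rw [intervalIntegral.integral_const, Finset.sum_const, nsmul_eq_mul, mul_one]
    push_cast
    simp
  -- split off the diagonal
  have hsplit : ∑ n ∈ P, ∑ n' ∈ P, c n n' * S n n' =
      (H + 1) * ((b - a) * s.card : ℝ) + ∑ n ∈ P, ∑ n' ∈ P.erase n, c n n' * S n n' := by
    have h1 : ∀ n ∈ P, ∑ n' ∈ P, c n n' * S n n' = c n n * S n n + ∑ n' ∈ P.erase n, c n n' * S n n' :=
      fun n hn => (Finset.add_sum_erase P (fun n' => c n n' * S n n') hn).symm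
    rw [Finset.sum_congr rfl h1, Finset.sum_add_distrib, Finset.sum_congr rfl hdiag, Finset.sum_const,
      hP, Nat.card_Ioc, tsub_zero, nsmul_eq_mul]
    push_cast
    ring
  -- bound the off-diagonal terms
  have hoff : ‖∑ n ∈ P, ∑ n' ∈ P.erase n, c n n' * S n n'‖ ≤
      (H + 1) * ∑ d ∈ (Icc (-(H : ℤ)) H).erase 0,
        ‖∑ i ∈ s, (𝐞 ((d : ℝ) * x i) : ℂ)‖ / (Real.pi * |(d : ℝ)|) := by
    set F : ℤ → ℝ := fun d => ‖∑ i ∈ s, (𝐞 ((d : ℝ) * x i) : ℂ)‖ / (Real.pi * |(d : ℝ)|) with hF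
    have hF0 : ∀ d, 0 ≤ F d := fun d => by positivity
    refine le_trans ?_ (sum_sum_erase_le H F hF0)
    refine (norm_sum_le _ _).trans (Finset.sum_le_sum fun n hn => ?_)
    refine (norm_sum_le _ _).trans (Finset.sum_le_sum fun n' hn' => ?_)
    have hne : n' ≠ n := (Finset.mem_erase.mp hn').1
    have hd : ((n' : ℝ) - n) ≠ 0 := by
      rw [sub_ne_zero]; exact_mod_cast hne
    rw [norm_mul]
    have hcb : ‖c n n'‖ ≤ 1 / (Real.pi * |(n' : ℝ) - n|) := norm_integral_fourierChar_mul_le hd a b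
    have hSd : S n n' = ∑ i ∈ s, (𝐞 ((((n : ℤ) - n' : ℤ) : ℝ) * x i) : ℂ) := by
      simp only [hS]; push_cast; rfl
    simp only [hF]
    rw [← hSd, show |(((n : ℤ) - n' : ℤ) : ℝ)| = |(n' : ℝ) - n| by push_cast; rw [abs_sub_comm]]
    calc ‖c n n'‖ * ‖S n n'‖ ≤ 1 / (Real.pi * |(n' : ℝ) - n|) * ‖S n n'‖ :=
          mul_le_mul_of_nonneg_right hcb (norm_nonneg _)
      _ = ‖S n n'‖ / (Real.pi * |(n' : ℝ) - n|) := by ring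
  -- conclude
  have hreal : (∑ i ∈ s, ∫ t in a..b, fejerKernel H (x i - t)) - (b - a) * s.card =
      (((H : ℂ) + 1)⁻¹ * ∑ n ∈ P, ∑ n' ∈ P.erase n, c n n' * S n n').re := by
    have h := hsum
    rw [hsplit, mul_add, ← mul_assoc, inv_mul_cancel₀ hH, one_mul] at h
    have h' := congrArg Complex.re h
    simp only [Complex.ofReal_re, Complex.add_re] at h'
    linarith [h']
  rw [hreal]
  refine (Complex.abs_re_le_norm _).trans ?_
  rw [norm_mul, norm_inv, show ‖((H : ℂ) + 1)‖ = (H : ℝ) + 1 by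
    rw [show ((H : ℂ) + 1) = ((H + 1 : ℕ) : ℂ) by push_cast; ring, Complex.norm_natCast]; push_cast; ring]
  have hH' : (0 : ℝ) < H + 1 := by positivity
  rw [inv_mul_le_iff₀ hH']
  exact hoff

/-! ### The counting theorems -/

/-- **Upper bound**: for `0 < δ ≤ 1/4`, `(H+1)δ ≥ 1` and `α ≤ β ≤ α + 1`,
`#{i : {x_i − α} < β − α} ≤ (β − α)N + 2δN + 2N/((H+1)δ) + ∑_{0<|h|≤H} |∑_i e(h x_i)|/|h|`.
[folklore] -/
theorem card_filter_fract_lt_le {ι : Type*} (s : Finset ι) (x : ι → ℝ) {α β δ : ℝ}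
    (hαβ : α ≤ β) (hβα : β ≤ α + 1) (hδ : 0 < δ) (hδ4 : δ ≤ 1 / 4) (hH : 1 ≤ (H + 1) * δ) :
    ((s.filter fun i => Int.fract (x i - α) < β - α).card : ℝ) ≤
      (β - α) * s.card + 2 * δ * s.card + 2 * s.card / ((H + 1) * δ) +
        ∑ d ∈ (Icc (-(H : ℤ)) H).erase 0, ‖∑ i ∈ s, (𝐞 ((d : ℝ) * x i) : ℂ)‖ / |(d : ℝ)| := by
  classical
  have hHpos : (0 : ℝ) < H + 1 := by positivity
  have hδ2 : δ ≤ 1 / 2 := by linarith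
  set τ : ℝ := 1 / (2 * (H + 1) * δ) with hτ
  have hτ0 : 0 ≤ τ := by positivity
  have hτ2 : τ ≤ 1 / 2 := by
    rw [hτ, div_le_iff₀ (by positivity)]; nlinarith
  set g : ℝ → ℝ := fun y => ∫ t in (α - δ)..(β + δ), fejerKernel H (y - t) with hg
  -- Step 1: `g ≥ 0` and `g ≥ 1 − τ` on the counted points
  have hg0 : ∀ y, 0 ≤ g y := fun y =>
    intervalIntegral.integral_nonneg (by linarith) fun t _ => fejerKernel_nonneg H _
  have hg1 : ∀ y, Int.fract (y - α) < β - α → 1 - τ ≤ g y := by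
    intro y hy
    set k : ℤ := ⌊y - α⌋ with hk
    have hfr : Int.fract (y - α) = y - α - k := by rw [Int.fract, hk]
    have hy1 : α ≤ y - k := by have := Int.fract_nonneg (y - α); linarith
    have hy2 : y - k < β := by linarith
    have hsub : g y = ∫ u in (y - (β + δ))..(y - (α - δ)), fejerKernel H u := by
      simp only [hg]
      exact intervalIntegral.integral_comp_sub_left (fun u => fejerKernel H u) y
    rw [hsub]
    calc 1 - τ ≤ ∫ t in (-δ)..δ, fejerKernel H t := le_integral_fejerKernel_near_zero H hδ hδ2
      _ = ∫ t in (-δ)..δ, fejerKernel H (t + k) := by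
          refine intervalIntegral.integral_congr fun t _ => ?_
          exact (fejerKernel_add_intCast H t k).symm
      _ = ∫ u in (-δ + k)..(δ + k), fejerKernel H u :=
          intervalIntegral.integral_comp_add_right (fun u => fejerKernel H u) (k : ℝ)
      _ ≤ ∫ u in (y - (β + δ))..(y - (α - δ)), fejerKernel H u :=
          intervalIntegral.integral_mono_interval (by linarith) (by linarith) (by linarith)
            (Filter.Eventually.of_forall fun u => fejerKernel_nonneg H u)
            (intervalIntegrable_fejerKernel H _ _)
  -- Step 2: the count is at most `(∑ g(x_i))/(1 − τ)`
  have hm : (0 : ℝ) < 1 - τ := by linarith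
  have hcount : ((s.filter fun i => Int.fract (x i - α) < β - α).card : ℝ) * (1 - τ) ≤
      ∑ i ∈ s, g (x i) := by
    rw [Finset.card_filter, Nat.cast_sum, Finset.sum_mul]
    refine Finset.sum_le_sum fun i _ => ?_
    split_ifs with h
    · push_cast; rw [one_mul]; exact hg1 _ h
    · push_cast; rw [zero_mul]; exact hg0 _
  -- Step 3: the smoothed sum
  have hE := abs_sum_integral_fejerKernel_sub_le H s x (α - δ) (β + δ)
  set E : ℝ := ∑ d ∈ (Icc (-(H : ℤ)) H).erase 0,
    ‖∑ i ∈ s, (𝐞 ((d : ℝ) * x i) : ℂ)‖ / (Real.pi * |(d : ℝ)|) with hEdef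
  have hE0 : 0 ≤ E := Finset.sum_nonneg fun d _ => by positivity
  have hgsum : ∑ i ∈ s, g (x i) ≤ (β - α + 2 * δ) * s.card + E := by
    have := (abs_le.mp hE).2
    simp only [hg]
    linarith
  -- Step 4: `E ≤ (1/π) ∑ |S|/|d| ≤ (1/2) ∑ |S|/|d|` is not needed sharply: `2E ≤ ∑ |S|/|d|`
  set E' : ℝ := ∑ d ∈ (Icc (-(H : ℤ)) H).erase 0,
    ‖∑ i ∈ s, (𝐞 ((d : ℝ) * x i) : ℂ)‖ / |(d : ℝ)| with hE'def
  have hEE' : 2 * E ≤ E' := by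
    rw [hEdef, hE'def, Finset.mul_sum]
    refine Finset.sum_le_sum fun d hd => ?_
    have hd0 : (d : ℝ) ≠ 0 := by
      have := (Finset.mem_erase.mp hd).1; exact_mod_cast this
    have hπ : (2 : ℝ) ≤ Real.pi := by linarith [Real.pi_gt_three]
    rw [div_eq_mul_inv, div_eq_mul_inv, mul_inv, ← mul_assoc, ← mul_assoc]
    have hn : 0 ≤ ‖∑ i ∈ s, (𝐞 ((d : ℝ) * x i) : ℂ)‖ := norm_nonneg _
    have ha : 0 < |(d : ℝ)| := abs_pos.mpr hd0
    calc 2 * ‖∑ i ∈ s, (𝐞 ((d : ℝ) * x i) : ℂ)‖ * Real.pi⁻¹ * |(d : ℝ)|⁻¹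
        = (2 * Real.pi⁻¹) * (‖∑ i ∈ s, (𝐞 ((d : ℝ) * x i) : ℂ)‖ * |(d : ℝ)|⁻¹) := by ring
      _ ≤ 1 * (‖∑ i ∈ s, (𝐞 ((d : ℝ) * x i) : ℂ)‖ * |(d : ℝ)|⁻¹) := by
          refine mul_le_mul_of_nonneg_right ?_ (by positivity)
          rw [mul_inv_le_iff₀ (by positivity)]; linarith
      _ = ‖∑ i ∈ s, (𝐞 ((d : ℝ) * x i) : ℂ)‖ * |(d : ℝ)|⁻¹ := one_mul _
  -- Step 5: arithmetic
  set N : ℝ := (s.card : ℝ) with hN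
  set C : ℝ := ((s.filter fun i => Int.fract (x i - α) < β - α).card : ℝ) with hC
  have hN0 : 0 ≤ N := by positivity
  have hC0 : 0 ≤ C := by positivity
  have h1 : C * (1 - τ) ≤ (β - α + 2 * δ) * N + E := hcount.trans hgsum
  -- `C ≤ (1 + 2τ)(main + E)`
  have h2 : C ≤ (1 + 2 * τ) * ((β - α + 2 * δ) * N + E) := by
    have hpos : 0 ≤ (β - α + 2 * δ) * N + E := by
      have : 0 ≤ β - α + 2 * δ := by linarith
      positivity
    have h3 : C ≤ ((β - α + 2 * δ) * N + E) / (1 - τ) := by rwa [le_div_iff₀ hm]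
    refine h3.trans ?_
    rw [div_le_iff₀ hm]
    have : (1 : ℝ) ≤ (1 + 2 * τ) * (1 - τ) := by nlinarith
    nlinarith
  have hL : β - α + 2 * δ ≤ 3 / 2 := by linarith
  have hτN : 3 * τ * N ≤ 2 * N / ((H + 1) * δ) := by
    rw [hτ, le_div_iff₀ (by positivity)]
    have : 3 * (1 / (2 * (H + 1) * δ)) * N * ((H + 1) * δ) = 3 / 2 * N := by
      field_simp
    rw [this]; linarith
  calc C ≤ (1 + 2 * τ) * ((β - α + 2 * δ) * N + E) := h2
    _ = (β - α) * N + 2 * δ * N + 2 * τ * ((β - α + 2 * δ) * N) + (1 + 2 * τ) * E := by ring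
    _ ≤ (β - α) * N + 2 * δ * N + 2 * τ * (3 / 2 * N) + 2 * E := by
        have h4 : 2 * τ * ((β - α + 2 * δ) * N) ≤ 2 * τ * (3 / 2 * N) := by
          refine mul_le_mul_of_nonneg_left ?_ (by positivity)
          exact mul_le_mul_of_nonneg_right hL hN0
        have h5 : (1 + 2 * τ) * E ≤ 2 * E := by nlinarith
        linarith
    _ = (β - α) * N + 2 * δ * N + 3 * τ * N + 2 * E := by ring
    _ ≤ (β - α) * N + 2 * δ * N + 2 * N / ((H + 1) * δ) + E' := by linarith

/-- **Lower bound**: for `0 < δ ≤ 1/2` and `β ≤ α + 1` (trivial when `β − α < 2δ`),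
`#{i : {x_i − α} < β − α} ≥ (β − α)N − 2δN − N/((H+1)δ) − ∑_{0<|h|≤H} |∑_i e(h x_i)|/|h|`.
[folklore] -/
theorem le_card_filter_fract_lt {ι : Type*} (s : Finset ι) (x : ι → ℝ) {α β δ : ℝ}
    (hβα : β ≤ α + 1) (hδ : 0 < δ) (hδ2 : δ ≤ 1 / 2) :
    (β - α) * s.card - 2 * δ * s.card - s.card / ((H + 1) * δ) -
        ∑ d ∈ (Icc (-(H : ℤ)) H).erase 0, ‖∑ i ∈ s, (𝐞 ((d : ℝ) * x i) : ℂ)‖ / |(d : ℝ)| ≤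
      ((s.filter fun i => Int.fract (x i - α) < β - α).card : ℝ) := by
  classical
  have hHpos : (0 : ℝ) < H + 1 := by positivity
  set N : ℝ := (s.card : ℝ) with hN
  have hN0 : 0 ≤ N := by positivity
  set E' : ℝ := ∑ d ∈ (Icc (-(H : ℤ)) H).erase 0,
    ‖∑ i ∈ s, (𝐞 ((d : ℝ) * x i) : ℂ)‖ / |(d : ℝ)| with hE'def
  have hE'0 : 0 ≤ E' := Finset.sum_nonneg fun d _ => by positivity
  -- the degenerate case `β − α < 2δ`
  by_cases hwide : β - α < 2 * δ
  · have hC0 : (0 : ℝ) ≤ ((s.filter fun i => Int.fract (x i - α) < β - α).card : ℝ) := by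
      positivity
    have : (β - α) * N - 2 * δ * N ≤ 0 := by nlinarith
    have : 0 ≤ N / ((H + 1) * δ) := by positivity
    linarith
  rw [not_lt] at hwide
  set τ : ℝ := 1 / (2 * (H + 1) * δ) with hτ
  have hτ0 : 0 ≤ τ := by positivity
  set g : ℝ → ℝ := fun y => ∫ t in (α + δ)..(β - δ), fejerKernel H (y - t) with hg
  -- `g ≤ 1` everywhere
  have hg1 : ∀ y, g y ≤ 1 := by
    intro y
    have hsub : g y = ∫ u in (y - (β - δ))..(y - (α + δ)), fejerKernel H u := by
      simp only [hg]
      exact intervalIntegral.integral_comp_sub_left (fun u => fejerKernel H u) y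
    rw [hsub]
    calc ∫ u in (y - (β - δ))..(y - (α + δ)), fejerKernel H u
        ≤ ∫ u in (y - (β - δ))..(y - (β - δ) + 1), fejerKernel H u :=
          intervalIntegral.integral_mono_interval le_rfl (by linarith) (by linarith)
            (Filter.Eventually.of_forall fun u => fejerKernel_nonneg H u)
            (intervalIntegrable_fejerKernel H _ _)
      _ = 1 := by
          rw [(fejerKernel_periodic H).intervalIntegral_add_eq _ 0, zero_add]
          simpa using integral_fejerKernel H 0
  -- `g ≤ τ` off the counted points
  have hg2 : ∀ y, ¬ Int.fract (y - α) < β - α → g y ≤ τ := by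
    intro y hy
    rw [not_lt] at hy
    set k : ℤ := ⌊y - α⌋ with hk
    have hfr : Int.fract (y - α) = y - α - k := by rw [Int.fract, hk]
    have hy1 : β ≤ y - k := by linarith
    have hy2 : y - k < α + 1 := by have := Int.fract_lt_one (y - α); linarith
    have hsub : g y = ∫ u in (y - (β - δ))..(y - (α + δ)), fejerKernel H u := by
      simp only [hg]
      exact intervalIntegral.integral_comp_sub_left (fun u => fejerKernel H u) y
    rw [hsub]
    calc ∫ u in (y - (β - δ))..(y - (α + δ)), fejerKernel H u
        = ∫ u in (y - (β - δ))..(y - (α + δ)), fejerKernel H (u + (-k)) := by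
          refine intervalIntegral.integral_congr fun u _ => ?_
          rw [show (-(k : ℝ)) = ((-k : ℤ) : ℝ) by push_cast; ring]
          exact (fejerKernel_add_intCast H u (-k)).symm
      _ = ∫ u in (y - (β - δ) + -k)..(y - (α + δ) + -k), fejerKernel H u :=
          intervalIntegral.integral_comp_add_right (fun u => fejerKernel H u) (-(k : ℝ))
      _ ≤ ∫ u in δ..(1 - δ), fejerKernel H u :=
          intervalIntegral.integral_mono_interval (by linarith) (by linarith) (by linarith)
            (Filter.Eventually.of_forall fun u => fejerKernel_nonneg H u)
            (intervalIntegrable_fejerKernel H _ _)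
      _ ≤ τ := integral_fejerKernel_tail_le H hδ hδ2
  -- so `g(x_i) − τ ≤ 𝟙[counted]`
  have hcount : ∑ i ∈ s, g (x i) - τ * N ≤
      ((s.filter fun i => Int.fract (x i - α) < β - α).card : ℝ) := by
    rw [Finset.card_filter, Nat.cast_sum, hN, show τ * (s.card : ℝ) = ∑ i ∈ s, τ by
      rw [Finset.sum_const, nsmul_eq_mul, mul_comm], ← Finset.sum_sub_distrib]
    refine Finset.sum_le_sum fun i _ => ?_
    split_ifs with h
    · push_cast; linarith [hg1 (x i)]
    · push_cast; linarith [hg2 (x i) h]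
  -- the smoothed sum
  have hE := abs_sum_integral_fejerKernel_sub_le H s x (α + δ) (β - δ)
  set E : ℝ := ∑ d ∈ (Icc (-(H : ℤ)) H).erase 0,
    ‖∑ i ∈ s, (𝐞 ((d : ℝ) * x i) : ℂ)‖ / (Real.pi * |(d : ℝ)|) with hEdef
  have hgsum : (β - α - 2 * δ) * N - E ≤ ∑ i ∈ s, g (x i) := by
    have := (abs_le.mp hE).1
    simp only [hg]
    linarith
  have hEE' : E ≤ E' := by
    rw [hEdef, hE'def]
    refine Finset.sum_le_sum fun d hd => ?_
    have hd0 : (d : ℝ) ≠ 0 := by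
      have := (Finset.mem_erase.mp hd).1; exact_mod_cast this
    have ha : 0 < |(d : ℝ)| := abs_pos.mpr hd0
    refine div_le_div_of_nonneg_left (norm_nonneg _) ha ?_
    have hπ : (1 : ℝ) ≤ Real.pi := by linarith [Real.pi_gt_three]
    nlinarith
  have hτN : τ * N ≤ N / ((H + 1) * δ) := by
    rw [hτ, le_div_iff₀ (by positivity)]
    have : 1 / (2 * (H + 1) * δ) * N * ((H + 1) * δ) = N / 2 := by field_simp
    rw [this]; linarith
  linarith

end Literature.NumberTheory.Sieve.FejerCounting

end
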